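import Summits.Ventures.CertifiedManyBodySolver.Downfold.ThreeToOneBandClauses
import HarnessLib

/-!
# Three-band → one-band, v1: the `scale` switch, the token that claims one clause per EMITTED
# coordinate, the named direct-source token, the joined box and word transport

Venture CertifiedManyBodySolver, cell `pub/hubbard-downfold` (stage S1 = DOWNFOLDING FRONT END;
HUMAN RULING D-0096), seat hubbard-downfold-mod-4 (writer); amendment A1 + notes N1, N3 of the
reviewer's REVIEW v1 (hubbard-downfold-unc-3, 2026-08-26). APPEND-ONLY companion of
`Downfold.ThreeToOneBand` (v0): nothing there is changed, and v0's token implies v1's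
(`reductionTokenBV1_of_v0`). Everything here is PROVED.
WHAT THIS IS NOT: a certified statement about any material; not a claim that a cuprate IS a
one-band Hubbard model — that is the ASSUMPTION TOKEN, printed with every box, never discharged
inside Lean; no literature number lives here.

* §1 `BConfigV1` = v0 `BConfig` + the switch `scale : Bool` (reviewer N3, symmetric to `ratios`:
  when `false`, technique B abstains on `t_eV` and on `U/t`, which divides by B's scale — for boxes
  where B's absolute scale is ruled CONTEXT); `imageBV1 cfg E` = v0 `imageB` with those two
  coordinates suppressed when `scale = false` (`imageBV1_of_scale`: equal to `imageB` otherwise).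
* §2 `ReductionTokenBV1 cfg E p := ∀ i g, imageBV1 cfg E i = some g → CoordTokenB cfg E i (p i)`
  (reviewer A1: the token claims a clause ONLY for coordinates technique B actually emits —
  nothing under `ratios = false` about `t′`, nothing under `scale = false` about `t`);
  SOUNDNESS `imageBV1_mem_of_token`; sufficient forms `reductionTokenBV1_of_clauses`
  (switch-guarded list), `reductionTokenBV1_of_shared` (the reviewer's literal A1: one shared box
  point, ratio clause conditional on `ratios`, scale clause on `scale`), `reductionTokenBV1_of_v0`.
* §3 `DirectToken direct B p` (reviewer N1: the DIRECT source's assumption — «wherever `B`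
  abstains, every direct entry present encloses the material's value» — named so the box prints
  both tokens), `threeToOneBandV1 := direct.join (imageBV1 cfg E)` (`= threeToOneBand` when
  `scale = true`), the two doors `threeToOneBandV1_mem_of_token` / `_mem_of_direct`, WORD
  TRANSPORT `threeToOneBandV1_word`, inflation safety `holdsOn_direct_of_threeToOneBandV1`.
* §4 (appended) per-coordinate provenance: `threeToOneBandV1_mem_coordwise` /
  `threeToOneBandV1_word_coordwise` (at each coordinate name the load-bearing token: a direct entry
  enclosing `p i`, or an emitted B entry with B's clause, or both abstain), `coordwise_of_tokens`.
-/

namespace Summit.Ventures.CertifiedManyBodySolver.Downfold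

open NonemptyInterval Literature.Analysis.ValidatedNumerics
open Summit.Ventures.CertifiedManyBodySolver.Downfold.Emery

/-! ## §1 The v1 configuration (`scale` switch) and determination -/

/-- **v1 configuration of the technique-B reduction**: v0's `BConfig` (precision of `√`,
`Δ′`-subdivision, `ratios` switch, declared misfits `rT rTp rTpp`, optional one-band `U`, grade)
plus the SCALE SWITCH (reviewer N3): emit `t_eV` (and `U/t`, which divides by technique B's scale)
at all? For a box where technique B's absolute scale is ruled CONTEXT, `scale = false` and B
abstains on both, exactly as `ratios = false` makes it abstain on `tp/t`, `tpp/t`. [folklore] -/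
structure BConfigV1 extends BConfig where
  /-- emit the scale coordinates `t_eV` and `U/t`? -/
  scale : Bool

/-- **Technique B's v1 determination**: v0's `imageB` with `t_eV` and `U/t` suppressed when
`cfg.scale = false`; all other coordinates as in v0 (`tp/t`, `tpp/t` only under `ratios = true`
and a positive scale interval; `n = 2 − n_holes`; the rest undetermined). [folklore] -/
def imageBV1 (cfg : BConfigV1) (E : EmeryBox) : OneBandBox := fun i =>
  if cfg.scale = false ∧ (i = .tEV ∨ i = .UOverT) then none else imageB cfg.toBConfig E i

/-- With the scale switch on, the v1 determination IS v0's. [folklore] -/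
theorem imageBV1_of_scale {cfg : BConfigV1} (h : cfg.scale = true) (E : EmeryBox) :
    imageBV1 cfg E = imageB cfg.toBConfig E := by
  funext i
  simp [imageBV1, h]

/-- With the scale switch off, technique B abstains on `t_eV` and `U/t`. [folklore] -/
theorem imageBV1_of_noscale {cfg : BConfigV1} (h : cfg.scale = false) (E : EmeryBox) :
    imageBV1 cfg E .tEV = none ∧ imageBV1 cfg E .UOverT = none := by
  constructor <;> simp [imageBV1, h]

/-- Every entry v1 emits is the v0 entry at that coordinate. [folklore] -/
theorem imageB_eq_of_imageBV1_eq {cfg : BConfigV1} {E : EmeryBox} {i : OneBandCoord} {g : Entry}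
    (hg : imageBV1 cfg E i = some g) : imageB cfg.toBConfig E i = some g := by
  unfold imageBV1 at hg
  by_cases h : cfg.scale = false ∧ (i = .tEV ∨ i = .UOverT)
  · rw [if_pos h] at hg; simp at hg
  · rw [if_neg h] at hg; exact hg

/-- v1 abstains wherever v0 abstains (its support is contained in v0's). [folklore] -/
theorem imageBV1_eq_none_of {cfg : BConfigV1} {E : EmeryBox} {i : OneBandCoord}
    (h : imageB cfg.toBConfig E i = none) : imageBV1 cfg E i = none := by
  unfold imageBV1
  split_ifs with hc
  · rfl
  · exact h

/-- If v1 emits `t_eV` the scale switch is on. [folklore] -/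
theorem scale_of_imageBV1_tEV {cfg : BConfigV1} {E : EmeryBox} {g : Entry}
    (hg : imageBV1 cfg E .tEV = some g) : cfg.scale = true := by
  unfold imageBV1 at hg
  by_cases h : cfg.scale = false ∧ (OneBandCoord.tEV = .tEV ∨ OneBandCoord.tEV = .UOverT)
  · rw [if_pos h] at hg; simp at hg
  · cases hs : cfg.scale
    · exact absurd ⟨hs, Or.inl rfl⟩ h
    · rfl

/-- If v1 emits `U/t` the scale switch is on. [folklore] -/
theorem scale_of_imageBV1_UOverT {cfg : BConfigV1} {E : EmeryBox} {g : Entry}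
    (hg : imageBV1 cfg E .UOverT = some g) : cfg.scale = true := by
  unfold imageBV1 at hg
  by_cases h : cfg.scale = false ∧ (OneBandCoord.UOverT = .tEV ∨ OneBandCoord.UOverT = .UOverT)
  · rw [if_pos h] at hg; simp at hg
  · cases hs : cfg.scale
    · exact absurd ⟨hs, Or.inr rfl⟩ h
    · rfl

/-! ## §2 The v1 token: one clause per emitted coordinate -/

/-- **ASSUMPTION TOKEN of the technique-B reduction, v1** (reviewer A1): for every one-band
coordinate technique B EMITS in configuration `cfg` on the three-band box `E`, the per-coordinate
clause `CoordTokenB` holds at the material's value `p i` — and nothing is claimed at coordinates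
where technique B abstains (ratios off, scale off, inputs absent, scale interval touching `0`).
A predicate on `p`, i.e. a HYPOTHESIS of every downstream statement. [folklore] -/
def ReductionTokenBV1 (cfg : BConfigV1) (E : EmeryBox) (p : OneBandCoord → ℝ) : Prop :=
  ∀ i g, imageBV1 cfg E i = some g → CoordTokenB cfg.toBConfig E i (p i)

/-- **SOUNDNESS of the v1 determination**: positive `t_pd` entry and the v1 token put `p` in
`imageBV1 cfg E`. [folklore] -/
theorem imageBV1_mem_of_token {cfg : BConfigV1} {E : EmeryBox} {p : OneBandCoord → ℝ}
    (hA0 : ∀ eA, E .tpd = some eA → 0 < eA.encl.fst) (tok : ReductionTokenBV1 cfg E p) :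
    (imageBV1 cfg E).Mem p :=
  fun i g hg => mem_of_coordTokenB hA0 (tok i g hg) (imageB_eq_of_imageBV1_eq hg)

/-- **Switch-guarded clause list ⇒ token**: the scale clauses under `scale = true`, the ratio
clauses under `ratios = true`, the filling clause always, suffice. [folklore] -/
theorem reductionTokenBV1_of_clauses {cfg : BConfigV1} {E : EmeryBox} {p : OneBandCoord → ℝ}
    (hS : cfg.scale = true → CoordTokenB cfg.toBConfig E .tEV (p .tEV) ∧
      CoordTokenB cfg.toBConfig E .UOverT (p .UOverT))
    (hR : cfg.ratios = true → CoordTokenB cfg.toBConfig E .tpOverT (p .tpOverT) ∧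
      CoordTokenB cfg.toBConfig E .tppOverT (p .tppOverT))
    (hN : CoordTokenB cfg.toBConfig E .filling (p .filling)) : ReductionTokenBV1 cfg E p := by
  intro i g hg
  cases i with
  | tEV => exact (hS (scale_of_imageBV1_tEV hg)).1
  | UOverT => exact (hS (scale_of_imageBV1_UOverT hg)).2
  | tpOverT => exact (hR (ratios_of_imageB_tpOverT (imageB_eq_of_imageBV1_eq hg))).1
  | tppOverT => exact (hR (ratios_of_imageB_tppOverT (imageB_eq_of_imageBV1_eq hg))).2
  | filling => exact hN
  | tperpOverT => trivial
  | VOverT => trivial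
  | WEV => trivial
  | dsd => trivial
  | JmeV => trivial

/-- **The reviewer's literal A1 form ⇒ token**: ONE shared box point `(Δ, t_pd, t_pp, t_pp′)` and
one `t > 0` within `rT` of `tB4`; under `scale = true` the material's `t_eV` is that `t` and the
supplied `U` determination encloses `t · (U/t)`; under `ratios = true` some `t′`, `t″` within
`rTp`, `rTpp` of `tpB4`, `tppB4` give the material's `tp/t = t′/t`, `tpp/t = t″/t`; the filling
entry encloses `2 − n`. [folklore] -/
theorem reductionTokenBV1_of_shared {cfg : BConfigV1} {E : EmeryBox} {p : OneBandCoord → ℝ}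
    (h : ∃ Δ a b c t : ℝ, EmeryPoint E Δ a b c ∧ |t - tB4 Δ a b c| ≤ (cfg.rT : ℚ) ∧ 0 < t ∧
      (cfg.scale = true → p .tEV = t ∧ ∀ eU, cfg.uEV = some eU → eU.Mem (t * p .UOverT)) ∧
      (cfg.ratios = true → ∃ tp tpp : ℝ, |tp - tpB4 Δ a b c| ≤ (cfg.rTp : ℚ) ∧
        |tpp - tppB4 Δ a b c| ≤ (cfg.rTpp : ℚ) ∧ p .tpOverT = tp / t ∧ p .tppOverT = tpp / t))
    (hN : ∀ eN, E .nHoles = some eN → eN.Mem (2 - p .filling)) : ReductionTokenBV1 cfg E p := by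
  obtain ⟨Δ, a, b, c, t, hpt, ht, ht0, hS, hR⟩ := h
  have nT : NearTB cfg.toBConfig E t := ⟨Δ, a, b, c, hpt, ht⟩
  refine reductionTokenBV1_of_clauses (fun hs => ?_) (fun hr => ?_) hN
  · obtain ⟨hpt', hU⟩ := hS hs
    refine ⟨?_, fun eU heU => ⟨t, t * p .UOverT, nT, hU eU heU, ?_⟩⟩
    · show NearTB cfg.toBConfig E (p .tEV)
      rw [hpt']
      exact nT
    · field_simp
  · obtain ⟨tp, tpp, htp, htpp, hptp, hptpp⟩ := hR hr
    exact ⟨⟨t, tp, nT, ⟨Δ, a, b, c, hpt, htp⟩, hptp⟩, ⟨t, tpp, nT, ⟨Δ, a, b, c, hpt, htpp⟩, hptpp⟩⟩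

/-- **v0 ⇒ v1**: v0's (stronger, partly idle) token implies the v1 token in any configuration
extending it. [folklore] -/
theorem reductionTokenBV1_of_v0 {cfg : BConfigV1} {E : EmeryBox} {p : OneBandCoord → ℝ}
    (tok : ReductionTokenB cfg.toBConfig E p) : ReductionTokenBV1 cfg E p := by
  obtain ⟨Δ, a, b, c, t, tp, tpp, hΔ, ha, hb, hc, ht, htp, htpp, ht0, hpt, hptp, hptpp⟩ := tok.1
  refine reductionTokenBV1_of_shared ⟨Δ, a, b, c, t, ⟨hΔ, ha, hb, hc⟩, ht, ht0, fun _ => ⟨hpt, ?_⟩,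
    fun _ => ⟨tp, tpp, htp, htpp, hptp, hptpp⟩⟩ tok.2.2
  intro eU heU
  rw [← hpt]
  exact tok.2.1 eU heU

/-! ## §3 The direct token, the joined box, word transport -/

/-- **ASSUMPTION TOKEN of the DIRECT source** relative to a second determination `B` (reviewer
N1): wherever `B` abstains, every direct entry present (one-band Wannier fit, one-band cRPA `U`,
literature value) encloses the material's value. Printed with the box beside technique B's token.
[folklore] -/
def DirectToken (direct B : OneBandBox) (p : OneBandCoord → ℝ) : Prop :=
  ∀ i, B i = none → ∀ e, direct i = some e → e.Mem (p i)

/-- Full direct enclosure is a direct token relative to any second source. [folklore] -/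
theorem directToken_of_mem {direct B : OneBandBox} {p : OneBandCoord → ℝ} (h : direct.Mem p) :
    DirectToken direct B p :=
  fun i _ e he => h i e he

/-- **The typed three-band → one-band statement, v1**: the box handed to S2 is the JOIN of the
direct one-band determinations with technique B's v1 determination (an absent entry abstains;
both present ⇒ hull). [folklore] -/
def threeToOneBandV1 (cfg : BConfigV1) (E : EmeryBox) (direct : OneBandBox) : OneBandBox :=
  direct.join (imageBV1 cfg E)

/-- With the scale switch on, the v1 box IS the v0 box. [folklore] -/
theorem threeToOneBandV1_of_scale {cfg : BConfigV1} (h : cfg.scale = true) (E : EmeryBox)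
    (direct : OneBandBox) : threeToOneBandV1 cfg E direct = threeToOneBand cfg.toBConfig E direct := by
  simp only [threeToOneBandV1, threeToOneBand, imageBV1_of_scale h]

/-- **INFL-3to1 SOUNDNESS, v1 (door 1)**: positive `t_pd` entry, technique B's v1 token, and the
direct token where B abstains put `p` in the delivered box. [folklore] -/
theorem threeToOneBandV1_mem_of_token {cfg : BConfigV1} {E : EmeryBox} {direct : OneBandBox}
    {p : OneBandCoord → ℝ} (hA0 : ∀ eA, E .tpd = some eA → 0 < eA.encl.fst)
    (tok : ReductionTokenBV1 cfg E p) (hdir : DirectToken direct (imageBV1 cfg E) p) :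
    (threeToOneBandV1 cfg E direct).Mem p := by
  have himg := imageBV1_mem_of_token hA0 tok
  refine Box.mem_join fun i => ?_
  cases hI : imageBV1 cfg E i with
  | some f => exact Or.inr (Or.inl ⟨f, rfl, himg i f hI⟩)
  | none =>
    cases hDd : direct i with
    | none => exact Or.inr (Or.inr ⟨rfl, rfl⟩)
    | some e => exact Or.inl ⟨e, rfl, hdir i hI e hDd⟩

/-- **Door 2**: full direct enclosure plus technique B's clause at every coordinate the direct
source leaves undetermined and B emits. [folklore] -/
theorem threeToOneBandV1_mem_of_direct {cfg : BConfigV1} {E : EmeryBox} {direct : OneBandBox}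
    {p : OneBandCoord → ℝ} (hA0 : ∀ eA, E .tpd = some eA → 0 < eA.encl.fst) (hp : direct.Mem p)
    (himg : ∀ i, direct i = none → ∀ g, imageBV1 cfg E i = some g →
      CoordTokenB cfg.toBConfig E i (p i)) :
    (threeToOneBandV1 cfg E direct).Mem p := by
  refine Box.mem_join fun i => ?_
  cases hDd : direct i with
  | some e => exact Or.inl ⟨e, rfl, hp i e hDd⟩
  | none =>
    cases hI : imageBV1 cfg E i with
    | none => exact Or.inr (Or.inr ⟨rfl, rfl⟩)
    | some g =>
      exact Or.inr (Or.inl ⟨g, rfl,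
        mem_of_coordTokenB hA0 (himg i hDd g hI) (imageB_eq_of_imageBV1_eq hI)⟩)

/-- **WORD TRANSPORT, v1** (the interface S2 consumes): a word certified on the delivered box
holds at the material's effective parameters under the two printed tokens. [folklore] -/
theorem threeToOneBandV1_word {cfg : BConfigV1} {E : EmeryBox} {direct : OneBandBox}
    {W : (OneBandCoord → ℝ) → Prop} (hW : HoldsOn W (threeToOneBandV1 cfg E direct))
    {p : OneBandCoord → ℝ} (hA0 : ∀ eA, E .tpd = some eA → 0 < eA.encl.fst)
    (tok : ReductionTokenBV1 cfg E p) (hdir : DirectToken direct (imageBV1 cfg E) p) : W p :=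
  hW p (threeToOneBandV1_mem_of_token hA0 tok hdir)

/-- **Inflation safety, v1** (reviewer R6): if technique B determines no coordinate the direct
box leaves undetermined, every word certified on the delivered box holds on the direct box.
[folklore] -/
theorem holdsOn_direct_of_threeToOneBandV1 {cfg : BConfigV1} {E : EmeryBox} {direct : OneBandBox}
    {W : (OneBandCoord → ℝ) → Prop} (hW : HoldsOn W (threeToOneBandV1 cfg E direct))
    (hsupp : ∀ i, direct i = none → imageBV1 cfg E i = none) : HoldsOn W direct :=
  hW.of_refines (Box.refines_join_left hsupp)


/-! ## §4 Per-coordinate provenance (appended 2026-08-26, same writer): which token is load-bearing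
at which coordinate -/

/-- **PER-COORDINATE PROVENANCE DOOR.** The delivered box encloses `p` as soon as, at EVERY
coordinate, one of the following is named: a direct entry enclosing `p i` (TOKEN-DIRECT load-bearing
there), or an entry technique B emits together with B's clause at `p i` (TOKEN-B load-bearing there),
or both sources abstain. This is the form in which a box of record prints provenance per row; the two
doors of §3 are its uniform special cases. [folklore] -/
theorem threeToOneBandV1_mem_coordwise {cfg : BConfigV1} {E : EmeryBox} {direct : OneBandBox}
    {p : OneBandCoord → ℝ} (hA0 : ∀ eA, E .tpd = some eA → 0 < eA.encl.fst)
    (h : ∀ i, (∃ e, direct i = some e ∧ e.Mem (p i)) ∨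
      (∃ g, imageBV1 cfg E i = some g ∧ CoordTokenB cfg.toBConfig E i (p i)) ∨
      (direct i = none ∧ imageBV1 cfg E i = none)) :
    (threeToOneBandV1 cfg E direct).Mem p := by
  refine Box.mem_join fun i => ?_
  rcases h i with hd | ⟨g, hg, hc⟩ | hn
  · exact Or.inl hd
  · exact Or.inr (Or.inl ⟨g, hg, mem_of_coordTokenB hA0 hc (imageB_eq_of_imageBV1_eq hg)⟩)
  · exact Or.inr (Or.inr hn)

/-- **WORD TRANSPORT with per-coordinate provenance**: a word certified on the delivered box holds at
`p` under the per-coordinate assignment of load-bearing tokens. [folklore] -/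
theorem threeToOneBandV1_word_coordwise {cfg : BConfigV1} {E : EmeryBox} {direct : OneBandBox}
    {W : (OneBandCoord → ℝ) → Prop} (hW : HoldsOn W (threeToOneBandV1 cfg E direct))
    {p : OneBandCoord → ℝ} (hA0 : ∀ eA, E .tpd = some eA → 0 < eA.encl.fst)
    (h : ∀ i, (∃ e, direct i = some e ∧ e.Mem (p i)) ∨
      (∃ g, imageBV1 cfg E i = some g ∧ CoordTokenB cfg.toBConfig E i (p i)) ∨
      (direct i = none ∧ imageBV1 cfg E i = none)) : W p :=
  hW p (threeToOneBandV1_mem_coordwise hA0 h)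

/-- The B-token plus the direct token IS a per-coordinate assignment (door 1 recovered): at each
coordinate B emits, TOKEN-B is load-bearing; elsewhere TOKEN-DIRECT. [folklore] -/
theorem coordwise_of_tokens {cfg : BConfigV1} {E : EmeryBox} {direct : OneBandBox}
    {p : OneBandCoord → ℝ} (tok : ReductionTokenBV1 cfg E p)
    (hdir : DirectToken direct (imageBV1 cfg E) p) (i : OneBandCoord) :
    (∃ e, direct i = some e ∧ e.Mem (p i)) ∨
      (∃ g, imageBV1 cfg E i = some g ∧ CoordTokenB cfg.toBConfig E i (p i)) ∨
      (direct i = none ∧ imageBV1 cfg E i = none) := by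
  cases hI : imageBV1 cfg E i with
  | some g => exact Or.inr (Or.inl ⟨g, rfl, tok i g hI⟩)
  | none =>
    cases hDd : direct i with
    | none => exact Or.inr (Or.inr ⟨rfl, rfl⟩)
    | some e => exact Or.inl ⟨e, rfl, hdir i hI e hDd⟩

end Summit.Ventures.CertifiedManyBodySolver.Downfold
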